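import Literature.Barriers.QuantumAdvantage.TQBFSavitchCode
import Literature.Barriers.QuantumAdvantage.TQBFCodewords
import Literature.Computability.Complexity.FoldCatBricks
import HarnessLib

/-!
# `TQBF` is `PSPACE`-hard, IV: brick emitters for the leaves of the step formula of a flat program

Arora–Barak 2009, Thm. 4.13, second half of the proof ("ψ can be computed in polynomial time",
p. 112). The generic part of that claim — the code of the prenex Savitch formula is computed in
polynomial time from generators of the step formula `Φ(a, b)`, the acceptance formula, the start
word and the block length — is part III, `TQBFSavitchCode.lean` (`codeFP_encode_savitchQBF`, in the
typed `CodeFP` algebra). What remains for a flat program is the generator of ITS step formula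
`stepTplB Λ P a b` (`TQBFFlatStep.lean`, part V `TQBFEmitStep.lean`): a conjunction, unrolled along
the program, of some ten block (in)equalities per instruction whose bases are `a + off`, `b + off'`
for the two block bases `a`, `b` handed over in BINARY by part III (it calls `Φ` at `(3Nm, 3Nm + N)`)
and whose offsets and lengths (`H + 1 + k·Wr`, `k·Wr`, `(cap - 1)·Wc`, …) are affine in the region
width `Wr`, again a binary numeral on the emitter's record; block CONSTANTS (`pcIs`, cell contents)
sit at such arbitrary binary bases too. This file supplies the leaf emitters for that unrolled
emitter as explicit brick functions (`BrickAlgebra.lean`, `FoldBricks.lean`, `FoldCatBricks.lean`)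
with exact-value lemmas in the `simp`-normal form part V rewrites with:

* `varCodeF (bin u) = code (var u)`, `bitEqF ⟨bin u, bin v⟩ = code (bitEq u v)`;
* `vecEqF ⟨⟨pad, ⟨bin a, bin b⟩⟩, bin n⟩ = code (vecEq a b n)` for `n ≤ |pad|` — block equality with a
  BINARY length, through the concatenation fold `ccatF Q p f` = the toolkit's `Brick.foldCat`
  (`FoldCatBricks.lean`) fed a binary round count (`ccatF_apply`, `ccatF_mem_FP`, built on
  `pclipF` / `foldLoop_pclipF_mem_FP` / `foldAcc_pclipF`);
* `vecConstCF w (bin a) = code (vecConst a w)` — a CONSTANT word `w` at a binary base (unrolled along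
  `w`; `litF`, `succBinF`);
* the token-counting transducer `sizeT` on the states `TQBFEval.PS` of the payload transducer of
  `TQBFCodewords.lean` (`sizeT_eval_code`: `code φ ↦ 1^{size φ}`) and
  `encodeF (code φ) = encodingPropForm.encode φ`, which turns any code generator into a generator of
  the tree's formula code without closed-form size bookkeeping;
* the codes of the combinators as counted concatenations (`code_vecEq_ccat`, `code_bitEq_var`,
  `code_bitLit_cond`, `code_impF`; the flattened forms `code_bigConj`, `code_vecEq`, … are part III's).

Twins (tree convention, cf. `FoldCatBricks.lean`): part III's `CodeFP` generators `codeFP_varCode`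
(≈ `varCodeF`), `codeFP_bitEq` (≈ `bitEqF`), `codeFP_vecEq` (length in UNARY, ≈ `vecEqF`) and
`codeFP_vecConst` (base `0`, word read off the input; no based constant-word form) are the canonical
family for the generic assembly and are what part VI feeds; the functions here are the explicit,
binary-count forms composed INSIDE the instruction-level emitter of part V, whose value lemma
(`stepEmit_apply`) is an equational computation on records `⟨pad, ⟨bin a, ⟨bin b, bin Wr⟩⟩⟩` — an
existential `CodeFP` witness per leaf would not compose under the toolkit's `foldLoop`/`fanoutFn`
terms without choice, and a unary length per leaf would need a capped binary-to-unary conversion at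
every one of the `O(|P|·N)` leaves. Nothing of part III is re-derived: its `code_*` lemmas and
`varCode` are imported and used.

## References

* S. Arora, B. Barak, *Computational Complexity: A Modern Approach*, CUP 2009, Thm. 4.13 (proof,
  second half), §1.3 (polynomial time is closed under composition and bounded loops), §0.1
  (codes) [AroraBarakCC2009].
-/

noncomputable section

namespace Literature.Barriers.QuantumAdvantage

open _root_.Computability Literature.Computability.Complexity Brick Plumb Polynomial

namespace TQBFRed

/-! ### Codes of the combinators -/

/-- Code of an implication. [folklore] -/
theorem code_impF (A B : PropForm ℕ) : (impF A B).code = [true, true, true, true, false] ++ A.code ++ B.code := by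
  simp [impF, PropForm.code]

/-- Code of a bit equality, over the codes of its two variables. [folklore] -/
theorem code_bitEq_var (u v : ℕ) : (bitEq u v).code = [true, true, true, true, true, false] ++ (PropForm.var u).code ++
    (PropForm.var v).code ++ [true, true, false, true, false] ++ (PropForm.var u).code ++ [true, false] ++ (PropForm.var v).code := by
  simp [bitEq, PropForm.code]

/-- Code of a block equality, as a counted concatenation. [folklore] -/
theorem code_vecEq_ccat (a b N : ℕ) :
    (vecEq a b N).code = ccat (fun j => [true, true, false] ++ (bitEq (a + j) (b + j)).code) N ++ [false, true, true] := by
  rw [vecEq, code_bigConj]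
  congr 1
  induction N with
  | zero => rfl
  | succ N ih => rw [List.range_succ, List.map_append, List.map_append, List.flatten_append, ih, ccat_succ]; simp

/-- Code of a literal, by cases on its polarity (`cond`). [folklore] -/
theorem code_bitLit_cond (u : ℕ) (b : Bool) :
    (bitLit u b).code = (cond b [] [true, false]) ++ (PropForm.var u).code := by
  cases b <;> rfl

/-- Code of an empty block constant. [folklore] -/
theorem code_vecConst_nil (a : ℕ) : (vecConst a []).code = [false, true, true] := rfl

/-- Code of a nonempty block constant. [folklore] -/
theorem code_vecConst_cons (a : ℕ) (b : Bool) (w : List Bool) :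
    (vecConst a (b :: w)).code = [true, true, false] ++ (bitLit a b).code ++ (vecConst (a + 1) w).code := by
  simp [vecConst, PropForm.code]

/-! ### The counted concatenation fold with a binary round count -/

/-- **The counted concatenation emitter**: on `⟨ctx, bin K⟩`, emit `f ⟨ctx, 1ʲ⟩` for `j = 0, …, K - 1`
(pieces clipped to `Q (|ctx|)` symbols by the toolkit's `Brick.pclipF`, `p (|ctx|)` rounds available).
This is the toolkit's concatenation fold `Brick.foldCat` (`FoldCatBricks.lean`, which counts its rounds
by the LENGTH of the second field) fed a BINARY round count — the loop record `⟨ctx, ⟨bin K, ⟨ε, ε⟩⟩⟩` of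
`foldLoop` directly — which is the form in which the leaf emitters below receive their block lengths
(affine expressions in binary numerals). [cite: AroraBarakCC2009, §1.3 (bounded loops)] -/
def ccatF (Q p : Polynomial ℕ) (f : List Bool → List Bool) : List Bool → List Bool :=
  sndPow 2 ∘ foldLoop appF (pclipF Q f) p ∘ fanoutFn fstF (fanoutFn sndF (fanoutFn (fun _ => []) (fun _ => [])))

/-- **`ccatF Q p f ∈ FP`** for every `f ∈ FP`. [cite: AroraBarakCC2009, §1.3] -/
theorem ccatF_mem_FP (Q p : Polynomial ℕ) {f : List Bool → List Bool} (hf : f ∈ FP) : ccatF Q p f ∈ FP :=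
  comp_mem_FP (sndPow_mem_FP 2) (comp_mem_FP (foldLoop_pclipF_mem_FP Q appF_mem_FP length_appF_le hf p)
    (fanoutFn_mem_FP fstF_mem_FP (fanoutFn_mem_FP sndF_mem_FP (fanoutFn_mem_FP (const_mem_FP _) (const_mem_FP _)))))

/-- **Value of `ccatF`**: the concatenation of the pieces, when enough rounds are available and the
pieces are short. [folklore] -/
theorem ccatF_apply {Q p : Polynomial ℕ} {f : List Bool → List Bool} {ctx : List Bool} {K : ℕ}
    (hK : K ≤ p.eval ctx.length) (hf : ∀ j < K, (f (boolPair ctx (ones j))).length ≤ Q.eval ctx.length) :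
    ccatF Q p f (boolPair ctx (encodeNat K)) = ccat (fun j => f (boolPair ctx (ones j))) K := by
  have h := foldLoop_apply appF (pclipF Q f) (p := p) (x := ctx) (k := K) hK 0 []
  rw [show (ones 0 : List Bool) = [] from rfl, Nat.zero_add] at h
  simp only [ccatF, Function.comp_apply, fanoutFn_apply, fstF_boolPair, sndF_boolPair]
  rw [h, sndPow_succ_boolPair, sndPow_succ_boolPair, sndPow_zero_boolPair,
    foldAcc_pclipF (fun j _ hj => hf j (by omega)), foldAcc_appF]
  simp

/-! ### Emitters: variables, bit equalities, block equalities -/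

/-- `varCodeF (bin u) = code (var u)`. [folklore] -/
def varCodeF : List Bool → List Bool := List.cons false ∘ List.cons false ∘ fanoutFn id (fun _ => [])

/-- Value of `varCodeF`. [folklore] -/
@[simp] theorem varCodeF_apply (w : List Bool) : varCodeF w = false :: false :: boolPair w [] := by
  simp [varCodeF]

/-- `varCodeF` on a numeral. [folklore] -/
theorem varCodeF_encodeNat (u : ℕ) : varCodeF (encodeNat u) = (PropForm.var u).code := by
  rw [varCodeF_apply, code_var, varCode]

/-- `varCodeF ∈ FP`. [folklore] -/
theorem varCodeF_mem_FP : varCodeF ∈ FP :=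
  comp_mem_FP (cons_mem_FP false) (comp_mem_FP (cons_mem_FP false) (fanoutFn_mem_FP OracleCompose.id_mem_FP (const_mem_FP _)))

/-- Length of `varCodeF`. [folklore] -/
theorem length_varCodeF (w : List Bool) : (varCodeF w).length = 2 * w.length + 4 := by
  rw [varCodeF_apply]; simp [length_boolPair]

/-- `bitEqF ⟨bin u, bin v⟩ = code (bitEq u v)`. [folklore] -/
def bitEqF : List Bool → List Bool := fun z =>
  (fun _ => [true, true, true, true, true, false]) z ++ ((varCodeF ∘ fstF) z ++ ((varCodeF ∘ sndF) z ++
    ((fun _ => [true, true, false, true, false]) z ++ ((varCodeF ∘ fstF) z ++ ((fun _ => [true, false]) z ++ (varCodeF ∘ sndF) z)))))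

/-- Value of `bitEqF` on a pair of numerals. [folklore] -/
theorem bitEqF_apply (u v : ℕ) : bitEqF (boolPair (encodeNat u) (encodeNat v)) = (bitEq u v).code := by
  simp only [bitEqF, Function.comp_apply, fstF_boolPair, sndF_boolPair, varCodeF_encodeNat, code_bitEq_var, List.append_assoc]

/-- `bitEqF ∈ FP`. [folklore] -/
theorem bitEqF_mem_FP : bitEqF ∈ FP :=
  append_mem_FP (const_mem_FP _) (append_mem_FP (comp_mem_FP varCodeF_mem_FP fstF_mem_FP)
    (append_mem_FP (comp_mem_FP varCodeF_mem_FP sndF_mem_FP) (append_mem_FP (const_mem_FP _)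
      (append_mem_FP (comp_mem_FP varCodeF_mem_FP fstF_mem_FP) (append_mem_FP (const_mem_FP _) (comp_mem_FP varCodeF_mem_FP sndF_mem_FP))))))

/-- Length of `bitEqF` on a pair. [folklore] -/
theorem length_bitEqF (a b : List Bool) : (bitEqF (boolPair a b)).length = 4 * a.length + 4 * b.length + 29 := by
  simp only [bitEqF, Function.comp_apply, fstF_boolPair, sndF_boolPair, List.length_append, length_varCodeF, List.length_cons,
    List.length_nil]
  omega

/-- The piece of the block-equality emitter: on `⟨⟨pad, ⟨bin a, bin b⟩⟩, 1ʲ⟩`,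
`110 · code (bitEq (a + j) (b + j))`. [folklore] -/
def vecEqPiece : List Bool → List Bool := fun z =>
  (fun _ => [true, true, false]) z ++ (bitEqF ∘ fanoutFn (addFn ∘ fanoutFn (nthF 1 ∘ fstF) (lenBinF ∘ sndF))
    (addFn ∘ fanoutFn (sndPow 1 ∘ fstF) (lenBinF ∘ sndF))) z

/-- `vecEqPiece ∈ FP`. [folklore] -/
theorem vecEqPiece_mem_FP : vecEqPiece ∈ FP :=
  append_mem_FP (const_mem_FP _) (comp_mem_FP bitEqF_mem_FP (fanoutFn_mem_FP
    (comp_mem_FP addFn_mem_FP (fanoutFn_mem_FP (comp_mem_FP (nthF_mem_FP 1) fstF_mem_FP) (comp_mem_FP lenBinF_mem_FP sndF_mem_FP)))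
    (comp_mem_FP addFn_mem_FP (fanoutFn_mem_FP (comp_mem_FP (sndPow_mem_FP 1) fstF_mem_FP) (comp_mem_FP lenBinF_mem_FP sndF_mem_FP)))))

/-- Value of the piece. [folklore] -/
theorem vecEqPiece_apply (pad : List Bool) (a b j : ℕ) :
    vecEqPiece (boolPair (boolPair pad (boolPair (encodeNat a) (encodeNat b))) (ones j)) =
      [true, true, false] ++ (bitEq (a + j) (b + j)).code := by
  simp only [vecEqPiece, Function.comp_apply, fanoutFn_apply, fstF_boolPair, sndF_boolPair, nthF_succ_boolPair, nthF_zero,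
    sndPow_succ_boolPair, sndPow_zero_boolPair, lenBinF_apply, addFn_boolPair, bitsToNat_encodeNat, bitEqF_apply]
  simp [ones]

/-- Length of the piece: linear in the context when `j, a, b` are dominated. [folklore] -/
theorem length_vecEqPiece_le (pad : List Bool) {a b j : ℕ} (hj : j ≤ pad.length) :
    (vecEqPiece (boolPair (boolPair pad (boolPair (encodeNat a) (encodeNat b))) (ones j))).length ≤
      48 * ((boolPair pad (boolPair (encodeNat a) (encodeNat b))).length + 1) := by
  rw [vecEqPiece_apply, List.length_append, ← bitEqF_apply, length_bitEqF]
  have h1 : (encodeNat (a + j)).length ≤ (encodeNat a).length + (encodeNat j).length + 1 := by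
    have := length_encodeNat_add_le (encodeNat a) (encodeNat j); simpa using this
  have h2 : (encodeNat (b + j)).length ≤ (encodeNat b).length + (encodeNat j).length + 1 := by
    have := length_encodeNat_add_le (encodeNat b) (encodeNat j); simpa using this
  have h3 : (encodeNat j).length ≤ j := CodeFP.length_natE_le j
  simp only [length_boolPair, List.length_cons, List.length_nil]
  omega

/-- **The block-equality emitter**: `⟨⟨pad, ⟨bin a, bin b⟩⟩, bin N⟩ ↦ code (vecEq a b N)` (for
`N ≤ |pad|`). [cite: AroraBarakCC2009, Thm. 4.13 (proof: "can be computed in polynomial time")] -/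
def vecEqF : List Bool → List Bool := fun z => ccatF (48 * (X + 1)) X vecEqPiece z ++ (fun _ => [false, true, true]) z

/-- `vecEqF ∈ FP`. [folklore] -/
theorem vecEqF_mem_FP : vecEqF ∈ FP := append_mem_FP (ccatF_mem_FP _ X vecEqPiece_mem_FP) (const_mem_FP _)

/-- **Value of `vecEqF`.** [folklore] -/
theorem vecEqF_apply (pad : List Bool) (a b : ℕ) {N : ℕ} (hN : N ≤ pad.length) :
    vecEqF (boolPair (boolPair pad (boolPair (encodeNat a) (encodeNat b))) (encodeNat N)) = (vecEq a b N).code := by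
  have hK : N ≤ X.eval (boolPair pad (boolPair (encodeNat a) (encodeNat b))).length := by
    rw [eval_X, length_boolPair]; omega
  have hf : ∀ j < N, (vecEqPiece (boolPair (boolPair pad (boolPair (encodeNat a) (encodeNat b))) (ones j))).length ≤
      (48 * (X + 1) : Polynomial ℕ).eval (boolPair pad (boolPair (encodeNat a) (encodeNat b))).length := fun j hj => by
    have := length_vecEqPiece_le pad (a := a) (b := b) (j := j) (by omega)
    simp only [eval_mul, eval_add, eval_X, eval_one, eval_ofNat]
    exact this
  have hfun : (fun j => vecEqPiece (boolPair (boolPair pad (boolPair (encodeNat a) (encodeNat b))) (ones j))) =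
      fun j => [true, true, false] ++ (bitEq (a + j) (b + j)).code := funext fun j => vecEqPiece_apply pad a b j
  rw [vecEqF, ccatF_apply hK hf, code_vecEq_ccat, hfun]

/-! ### Emitters: block constants -/

/-- The successor of a numeral: `bin a ↦ bin (a + 1)` (local brick; twins above other toolkits:
`HadamardGadgetDescBricks.succN`, `ShorPerfectPowerFP.succF`). [folklore] -/
def succBinF : List Bool → List Bool := addFn ∘ fanoutFn id (fun _ => [true])

/-- Value of `succBinF`. [folklore] -/
@[simp] theorem succBinF_encodeNat (a : ℕ) : succBinF (encodeNat a) = encodeNat (a + 1) := by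
  simp [succBinF, show bitsToNat [true] = 1 from rfl]

/-- `succBinF ∈ FP`. [folklore] -/
theorem succBinF_mem_FP : succBinF ∈ FP :=
  comp_mem_FP addFn_mem_FP (fanoutFn_mem_FP OracleCompose.id_mem_FP (const_mem_FP _))

/-- The code of a literal of polarity `b` on the variable of a numeral. [folklore] -/
def litF (b : Bool) : List Bool → List Bool := fun z => (fun _ => cond b [] [true, false]) z ++ varCodeF z

/-- Value of `litF`. [folklore] -/
theorem litF_encodeNat (b : Bool) (u : ℕ) : litF b (encodeNat u) = (bitLit u b).code := by
  rw [litF, varCodeF_encodeNat, code_bitLit_cond]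

/-- `litF b ∈ FP`. [folklore] -/
theorem litF_mem_FP (b : Bool) : litF b ∈ FP := append_mem_FP (const_mem_FP _) varCodeF_mem_FP

/-- **The block-constant emitter for a fixed word** `w`: `bin a ↦ code (vecConst a w)` (unrolled
along `w`). [cite: AroraBarakCC2009, Thm. 4.13 (proof: "plugging in the values C_start and C_accept")] -/
def vecConstCF : List Bool → (List Bool → List Bool)
  | [] => fun _ => [false, true, true]
  | b :: w => fun z => (fun _ => [true, true, false]) z ++ (litF b z ++ (vecConstCF w ∘ succBinF) z)

/-- **Value of `vecConstCF`.** [folklore] -/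
theorem vecConstCF_encodeNat : ∀ (w : List Bool) (a : ℕ), vecConstCF w (encodeNat a) = (vecConst a w).code
  | [], a => rfl
  | b :: w, a => by
    rw [vecConstCF, code_vecConst_cons]
    simp only [Function.comp_apply, litF_encodeNat, succBinF_encodeNat, vecConstCF_encodeNat w (a + 1), List.append_assoc]

/-- `vecConstCF w ∈ FP`. [folklore] -/
theorem vecConstCF_mem_FP : ∀ w : List Bool, vecConstCF w ∈ FP
  | [] => const_mem_FP _
  | b :: w => append_mem_FP (const_mem_FP _) (append_mem_FP (litF_mem_FP b) (comp_mem_FP (vecConstCF_mem_FP w) succBinF_mem_FP))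

/-! ### The size of a formula from its code: a token counter -/

/-! The token counter runs on the states `TQBFEval.PS` of the payload transducer of `TQBFCodewords.lean`
(token boundary `tk`, after the first tag bit `t1 b`, value bit of a constant `cst`, third tag bit of
a binary connective `t11`, inside a variable payload `vk o`). -/

/-- Transition of the token counter: emit `1` at every token boundary. [folklore] -/
def sizeStep : TQBFEval.PS → Bool → TQBFEval.PS × List Bool
  | .tk, b => (.t1 b, [true])
  | .t1 false, false => (.vk none, [])
  | .t1 false, true => (.cst, [])
  | .t1 true, false => (.tk, [])
  | .t1 true, true => (.t11, [])
  | .cst, _ => (.tk, [])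
  | .t11, _ => (.tk, [])
  | .vk none, b => (.vk (some b), [])
  | .vk (some b), b' => (if b = b' then .vk none else .tk, [])

/-- **The token counter**: on `PropForm.code φ` it emits `1^{size φ}` (`sizeT_eval_code`). [folklore] -/
def sizeT : FST TQBFEval.PS Bool Bool where
  init := .tk
  step := sizeStep
  front := fun _ => []
  keep := fun _ => true

/-- The transition of `sizeT` (definitional). [folklore] -/
@[simp] theorem sizeT_step (s : TQBFEval.PS) (b : Bool) : sizeT.step s b = sizeStep s b := rfl

/-- Skipping a doubled payload. [folklore] -/
theorem sizeT_run_vk_dbl (w rest : List Bool) :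
    sizeT.run (.vk none) ((w.flatMap fun b => [b, b]) ++ rest) = sizeT.run (.vk none) rest := by
  induction w with
  | nil => rfl
  | cons b w ih => simp [FST.run_cons, sizeStep, ih]

/-- **The token counter on a formula code** (followed by anything): one `1` per node. [folklore] -/
theorem sizeT_run_code : ∀ (φ : PropForm ℕ) (rest : List Bool),
    sizeT.run .tk (φ.code ++ rest) = ((sizeT.run .tk rest).1, List.replicate φ.size true ++ (sizeT.run .tk rest).2)
  | .var n, rest => by
    have h : (PropForm.var n).code ++ rest =
        false :: false :: (((encodeNat n).flatMap fun b => [b, b]) ++ (false :: true :: rest)) := by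
      simp [PropForm.code, boolPair]
    rw [h]
    simp [FST.run_cons, sizeStep, sizeT_run_vk_dbl, PropForm.size]
  | .const b, rest => by simp [PropForm.code, FST.run_cons, sizeStep, PropForm.size]
  | .neg φ, rest => by
    simp [PropForm.code, FST.run_cons, sizeStep, sizeT_run_code φ rest, PropForm.size, List.replicate_add]
  | .conj φ ψ, rest => by
    simp only [PropForm.code, List.cons_append, List.append_assoc, FST.run_cons, sizeT_step, sizeStep,
      sizeT_run_code φ (ψ.code ++ rest), sizeT_run_code ψ rest, PropForm.size]
    rw [show φ.size + ψ.size + 1 = 1 + (φ.size + ψ.size) by ring, List.replicate_add, List.replicate_add]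
    simp only [List.append_assoc, List.replicate_one, List.cons_append, List.nil_append]
  | .disj φ ψ, rest => by
    simp only [PropForm.code, List.cons_append, List.append_assoc, FST.run_cons, sizeT_step, sizeStep,
      sizeT_run_code φ (ψ.code ++ rest), sizeT_run_code ψ rest, PropForm.size]
    rw [show φ.size + ψ.size + 1 = 1 + (φ.size + ψ.size) by ring, List.replicate_add, List.replicate_add]
    simp only [List.append_assoc, List.replicate_one, List.cons_append, List.nil_append]

/-- **The token counter computes the unary size.** [folklore] -/
theorem sizeT_eval_code (φ : PropForm ℕ) : sizeT.eval φ.code = unaryEncodeNat φ.size := by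
  have h := sizeT_run_code φ []
  rw [List.append_nil] at h
  simp only [FST.eval, show sizeT.init = TQBFEval.PS.tk from rfl, h, FST.run_nil, List.append_nil,
    show sizeT.keep = fun _ => true from rfl, show sizeT.front = fun _ => [] from rfl, if_true, List.nil_append,
    unaryEncodeNat_eq_replicate]

/-- **From the code to the codeword**: `code φ ↦ ⟨1^{size φ}, code φ⟩ = encodingPropForm.encode φ`.
[cite: AroraBarakCC2009, §0.1] -/
def encodeF : List Bool → List Bool := fanoutFn sizeT.eval id

/-- `encodeF ∈ FP`. [folklore] -/
theorem encodeF_mem_FP : encodeF ∈ FP := fanoutFn_mem_FP sizeT.polyTimeComputable_eval OracleCompose.id_mem_FP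

/-- **Value of `encodeF` on a code.** [folklore] -/
theorem encodeF_code (φ : PropForm ℕ) : encodeF φ.code = encodingPropForm.encode φ := by
  rw [encodeF, fanoutFn_apply, sizeT_eval_code]
  rfl

end TQBFRed

end Literature.Barriers.QuantumAdvantage
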